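import Mathlib
import Summits.ValiantsHypothesis.ValiantsHypothesis.Theses.LiouvilleSarnak
import HarnessLib

/-!
# Route LiouvilleSarnak — support `AlignedTypeI` (stmt-ValiantsHypothesis-21040), line `characters_mod_2n`:
# the line's named propositions, and the dyadic fibre bookkeeping of the aligned row sums

Objects-and-bookkeeping file for the registered line `Cruxes/AlignedTypeI/Lines/characters_mod_2n.lean`
(planner val-width-lines-2, 2026-08-27; tagged «calibration-only»), whose registered stub
`stub_assembly : KMTBSImpliesAligned` is proved BY NAME in the companion
`Theorems/LiouvilleSarnakAlignedTypeICharactersMod2nAssembly.lean`.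

§0 puts the line's three propositions VERBATIM (same names, same bodies) into an importable module:
* `KMTVariance` — variance of `λ` over the odd classes mod `2^k`, `k₀ ≤ k ≤ n`, along `b < 2^n`, around a
  one-character main term (the line's cite-grade reading of Klurman–Mangerel–Teräväinen, Proc. LMS 127
  (2023), Thm 1.3, specialised to `f = λ`, `q = Q = 2^k`, `x = 2^(n+k)`);
* `TwistedLiouvilleSmall` — twisted Liouville sums to moduli `2^k`, `k ≤ n`, over `[1, 2^(n+k)]` are
  `o(2^(n+k))` uniformly (the line's cite-grade reading of Banks–Shparlinski, TAMS (2019), Thm 2.2 +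
  Siegel–Walfisz glue);
* `KMTBSImpliesAligned := KMTVariance → TwistedLiouvilleSmall → AlignedTypeI` (the stub's signature).

§1–§4 are the elementary bookkeeping the assembly needs: `λ(2^j x) = (-1)^j λ(x)`; the row sums
`T_n(a) = Σ_{b<2^n} λ(a + 2^n b + 1)` and class sums `A_{n,k}(u) = Σ_{b<2^n} λ(u + 2^k b)`; the dyadic
split `a + 1 = 2^(v₂(a+1)) · oddPart a`, the fibres `fib n k = {a < 2^n : v₂(a+1) = n - k}` partitioning
`Fin (2^n)` over `k ∈ [0, n]` (`sum_fiberwise`); on the fibre `k ≥ 1` the map `a ↦ oddPart a (mod 2^k)` is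
injective into the units and `|T_n(a)| = |A_{n,k}(oddPart a)|`, whence
`Σ_{a ∈ fib n k} |T_n(a)| ≤ Σ_{u ∈ (ℤ/2^k)ˣ} |A_{n,k}(u)|` (`fiber_sum_le_unit_sum`), and every fibre
contributes at most `2^(n+k)` (`fiber_sum_le_trivial`; the fibre `k = 0` is the single row `a + 1 = 2^n`).

HONEST FRAMING. Nothing cite-grade is asserted: `KMTVariance` and `TwistedLiouvilleSmall` appear in this
development ONLY AS HYPOTHESES of `KMTBSImpliesAligned`; they are NOT proved in the tree and NOT minted as
Literature facts here (their match with the printed theorems is the line's business). The item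
`AlignedTypeI` is not closed by these files; the milestone `DigitalBilinearLiouville` (stmt-14774) and the
route's cruxes are untouched; nothing here bears on `VP ≠ VNP` (NOT proved).
-/

set_option linter.dupNamespace false

noncomputable section

namespace Summit.ValiantsHypothesis.ValiantsHypothesis.Theorems.LiouvilleSarnak.AlignedTypeI.CharactersModTwoN

open Summit.ValiantsHypothesis.ValiantsHypothesis.Theses.LiouvilleSarnak

/-! ## §0 The line's named propositions (verbatim) -/

/-- KMT-type variance statement for `λ` to the moduli `2^k`, `k₀ ≤ k ≤ n`, progressions of length `2^n`
(verbatim the line's `KMTVariance`; a HYPOTHESIS statement — the line's cite-grade reading of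
Klurman–Mangerel–Teräväinen 2023 Thm 1.3; not asserted, not proved, not a minted fact). -/
def KMTVariance : Prop :=
  ∀ ε : ℝ, 0 < ε → ∃ k₀ n₀ : ℕ, ∀ n ≥ n₀, ∀ k : ℕ, k₀ ≤ k → k ≤ n →
    ∃ χ : DirichletCharacter ℂ (2 ^ k),
      ∑ u : (ZMod (2 ^ k))ˣ,
        ‖(∑ b : Fin (2 ^ n), ((ArithmeticFunction.liouville ((u : ZMod (2 ^ k)).val + 2 ^ k * (b : ℕ)) : ℤ) : ℂ))
          - χ (u : ZMod (2 ^ k)) / (Nat.totient (2 ^ k) : ℂ) *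
            ∑ m : Fin (2 ^ (n + k)), ((ArithmeticFunction.liouville ((m : ℕ) + 1) : ℤ) : ℂ) *
              star (χ (((m : ℕ) + 1 : ℕ) : ZMod (2 ^ k)))‖ ^ 2
        ≤ ε * 2 ^ k * 4 ^ n

/-- Twisted Liouville sums to moduli `2^k`, `k ≤ n`, over `[1, 2^{n+k}]` are `o(2^{n+k})` uniformly
(verbatim the line's `TwistedLiouvilleSmall`; a HYPOTHESIS statement — the line's cite-grade reading
of Banks–Shparlinski 2019 Thm 2.2 plus Siegel–Walfisz glue; not asserted, not proved, not a minted
fact). -/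
def TwistedLiouvilleSmall : Prop :=
  ∀ ε : ℝ, 0 < ε → ∃ n₀ : ℕ, ∀ n ≥ n₀, ∀ k ≤ n, ∀ χ : DirichletCharacter ℂ (2 ^ k),
    ‖∑ m : Fin (2 ^ (n + k)), ((ArithmeticFunction.liouville ((m : ℕ) + 1) : ℤ) : ℂ) *
        χ (((m : ℕ) + 1 : ℕ) : ZMod (2 ^ k))‖ ≤ ε * 2 ^ (n + k)

/-- The assembly glue as a named proposition: the two cite-grade inputs imply the rung
(verbatim the line's `KMTBSImpliesAligned` = the signature of the registered stub `stub_assembly`;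
proved in the companion file as `stub_assembly`). -/
def KMTBSImpliesAligned : Prop :=
  KMTVariance → TwistedLiouvilleSmall → AlignedTypeI


open ArithmeticFunction Finset
open scoped BigOperators

/-! ## §1 Liouville: the trivial bound (the dilation rule `λ(2^j x) = (-1)^j λ(x)` — the tree's
`LiouvilleSarnakAligned.liouville_two_pow_mul` — is re-derived inline where used, to keep this module
out of that file's import cone) -/

/-- `|λ(x)| ≤ 1`. [folklore] -/
theorem abs_liouville_le_one (x : ℕ) : |(liouville x : ℤ)| ≤ 1 := by
  rcases eq_or_ne x 0 with rfl | hx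
  · simp
  · rw [liouville_apply hx]
    rcases neg_one_pow_eq_or ℤ (cardFactors x) with h | h <;> rw [h] <;> simp

/-! ## §2 Row sums and class sums -/

/-- The row sum `T_n(a) = Σ_{b < 2^n} λ(a + 2^n b + 1)` of the aligned matrix. [folklore] -/
def rowSum (n a : ℕ) : ℤ := ∑ b : Fin (2 ^ n), liouville (a + 2 ^ n * (b : ℕ) + 1)

/-- The class sum `A_{n,k}(u) = Σ_{b < 2^n} λ(u + 2^k b)` (Liouville along the class `u (mod 2^k)`).
[folklore] -/
def classSum (n k u : ℕ) : ℤ := ∑ b : Fin (2 ^ n), liouville (u + 2 ^ k * (b : ℕ))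

/-- Dyadic split: if `a + 1 = 2^(n-k) u` with `k ≤ n` then `T_n(a) = (-1)^(n-k) A_{n,k}(u)`, since
`a + 2^n b + 1 = 2^(n-k) (u + 2^k b)`. [folklore] -/
theorem rowSum_eq_of_split {n k a u : ℕ} (hk : k ≤ n) (ha : a + 1 = 2 ^ (n - k) * u) :
    rowSum n a = (-1) ^ (n - k) * classSum n k u := by
  unfold rowSum classSum
  rw [Finset.mul_sum]
  refine Finset.sum_congr rfl fun b _ => ?_
  have h2 : 2 ^ (n - k) * 2 ^ k = 2 ^ n := by rw [← pow_add, Nat.sub_add_cancel hk]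
  have : a + 2 ^ n * (b : ℕ) + 1 = 2 ^ (n - k) * (u + 2 ^ k * (b : ℕ)) := by
    rw [mul_add, ← mul_assoc, h2]; omega
  -- `λ(2^j x) = (-1)^j λ(x)` (complete multiplicativity, `λ(2) = -1`)
  have hdil : ∀ j x : ℕ, liouville (2 ^ j * x) = (-1) ^ j * liouville x := by
    intro j x
    induction j with
    | zero => simp
    | succ j ih =>
      rw [pow_succ, mul_comm (2 ^ j) 2, mul_assoc, liouville_apply_mul, ih,
        liouville_apply two_ne_zero, cardFactors_apply_prime Nat.prime_two, pow_succ]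
      ring
  rw [this, hdil]

/-- `|T_n(a)| = |A_{n,k}(u)|` under the dyadic split. [folklore] -/
theorem abs_rowSum_eq_of_split {n k a u : ℕ} (hk : k ≤ n) (ha : a + 1 = 2 ^ (n - k) * u) :
    |rowSum n a| = |classSum n k u| := by
  rw [rowSum_eq_of_split hk ha, abs_mul, abs_pow, abs_neg, abs_one, one_pow, one_mul]

/-- Trivial bound `|A_{n,k}(u)| ≤ 2^n`. [folklore] -/
theorem abs_classSum_le (n k u : ℕ) : |classSum n k u| ≤ 2 ^ n := by
  unfold classSum
  refine (Finset.abs_sum_le_sum_abs _ _).trans ?_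
  calc ∑ b : Fin (2 ^ n), |(liouville (u + 2 ^ k * (b : ℕ)) : ℤ)|
      ≤ ∑ _b : Fin (2 ^ n), (1 : ℤ) := Finset.sum_le_sum fun b _ => abs_liouville_le_one _
    _ = 2 ^ n := by simp

/-- Trivial bound `|T_n(a)| ≤ 2^n`. [folklore] -/
theorem abs_rowSum_le (n a : ℕ) : |rowSum n a| ≤ 2 ^ n := by
  unfold rowSum
  refine (Finset.abs_sum_le_sum_abs _ _).trans ?_
  calc ∑ b : Fin (2 ^ n), |(liouville (a + 2 ^ n * (b : ℕ) + 1) : ℤ)|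
      ≤ ∑ _b : Fin (2 ^ n), (1 : ℤ) := Finset.sum_le_sum fun b _ => abs_liouville_le_one _
    _ = 2 ^ n := by simp

/-! ## §3 The dyadic fibres of `a ↦ a + 1` -/

/-- The 2-adic valuation of `a + 1`. [folklore] -/
def val2 (a : ℕ) : ℕ := padicValNat 2 (a + 1)

/-- `2^(v₂(a+1)) ∣ a + 1`. [folklore] -/
theorem two_pow_val2_dvd (a : ℕ) : 2 ^ val2 a ∣ a + 1 := pow_padicValNat_dvd

/-- `v₂(a+1) ≤ n` for `a < 2^n`. [folklore] -/
theorem val2_le {n : ℕ} (a : Fin (2 ^ n)) : val2 (a : ℕ) ≤ n := by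
  have h1 : 2 ^ val2 (a : ℕ) ≤ (a : ℕ) + 1 := Nat.le_of_dvd (Nat.succ_pos _) (two_pow_val2_dvd _)
  have h2 : (a : ℕ) + 1 ≤ 2 ^ n := a.isLt
  exact (Nat.pow_le_pow_iff_right (by norm_num)).1 (h1.trans h2)

/-- The odd part `(a + 1) / 2^(val2 a)`. [folklore] -/
def oddPart (a : ℕ) : ℕ := (a + 1) / 2 ^ val2 a

/-- The dyadic split `a + 1 = 2^(v₂(a+1)) · oddPart a`. [folklore] -/
theorem split_eq (a : ℕ) : a + 1 = 2 ^ val2 a * oddPart a :=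
  (Nat.mul_div_cancel' (two_pow_val2_dvd a)).symm

/-- The odd part is odd (maximality of the valuation). [folklore] -/
theorem oddPart_odd (a : ℕ) : Odd (oddPart a) := by
  rw [← Nat.not_even_iff_odd]
  intro heven
  obtain ⟨c, hc⟩ := heven
  have hdvd : 2 ^ (val2 a + 1) ∣ a + 1 := by
    rw [split_eq a, hc, pow_succ]
    exact ⟨c, by ring⟩
  exact pow_succ_padicValNat_not_dvd (p := 2) (Nat.succ_ne_zero a) hdvd

/-- The odd part is positive. [folklore] -/
theorem oddPart_pos (a : ℕ) : 0 < oddPart a := (oddPart_odd a).pos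

/-- For `val2 a = n - k` with `1 ≤ k ≤ n` and `a < 2^n`: the odd part is `< 2^k`. -/
theorem oddPart_lt {n k : ℕ} (a : Fin (2 ^ n)) (hk1 : 1 ≤ k) (hkn : k ≤ n)
    (hv : val2 (a : ℕ) = n - k) : oddPart (a : ℕ) < 2 ^ k := by
  have hle : oddPart (a : ℕ) ≤ 2 ^ k := by
    have h := split_eq (a : ℕ)
    rw [hv] at h
    have h2 : (a : ℕ) + 1 ≤ 2 ^ (n - k) * 2 ^ k := by
      rw [← pow_add, Nat.sub_add_cancel hkn]; exact a.isLt
    rw [h] at h2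
    exact Nat.le_of_mul_le_mul_left h2 (Nat.two_pow_pos _)
  rcases hle.lt_or_eq with h | h
  · exact h
  · exfalso
    have hodd := oddPart_odd (a : ℕ)
    rw [h] at hodd
    obtain ⟨k', rfl⟩ : ∃ k', k = k' + 1 := ⟨k - 1, by omega⟩
    rw [pow_succ] at hodd
    exact (Nat.not_even_iff_odd.2 hodd) (by simp)


/-! ## §4 Fibre sums are dominated by unit sums -/

/-- The odd part is prime to every power of two. [folklore] -/
theorem coprime_oddPart (k a : ℕ) : Nat.Coprime (oddPart a) (2 ^ k) :=
  (Nat.coprime_two_right.mpr (oddPart_odd a)).pow_right k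

/-- The unit of `ZMod (2^k)` carried by the odd part of `a + 1`. [folklore] -/
def unitOf (k a : ℕ) : (ZMod (2 ^ k))ˣ := ZMod.unitOfCoprime (oddPart a) (coprime_oddPart k a)

/-- The unit carried by the odd part has value the odd part, once `oddPart a < 2^k`. [folklore] -/
theorem unitOf_val {k a : ℕ} (hlt : oddPart a < 2 ^ k) :
    ((unitOf k a : (ZMod (2 ^ k))ˣ) : ZMod (2 ^ k)).val = oddPart a := by
  unfold unitOf
  rw [ZMod.coe_unitOfCoprime, ZMod.val_natCast, Nat.mod_eq_of_lt hlt]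

/-- The dyadic fibre `{a < 2^n : v₂(a+1) = n - k}`. [folklore] -/
def fib (n k : ℕ) : Finset (Fin (2 ^ n)) := Finset.univ.filter fun a => val2 (a : ℕ) = n - k

/-- Every `a < 2^n` lies in the fibre `k = n - v₂(a+1) ∈ [0, n]`. [folklore] -/
theorem sum_fiberwise (n : ℕ) (f : Fin (2 ^ n) → ℝ) :
    ∑ a, f a = ∑ k ∈ Finset.range (n + 1), ∑ a ∈ fib n k, f a := by
  rw [← Finset.sum_fiberwise_of_maps_to (s := Finset.univ) (t := Finset.range (n + 1))
    (g := fun a : Fin (2 ^ n) => n - val2 (a : ℕ)) (fun a _ => Finset.mem_range.2 (by omega))]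
  refine Finset.sum_congr rfl fun k hk => ?_
  refine Finset.sum_congr ?_ fun _ _ => rfl
  ext a
  simp only [fib, Finset.mem_filter, Finset.mem_univ, true_and]
  have := val2_le a
  have hk' := Finset.mem_range.1 hk
  omega

/-- **Fibre `k ≥ 1`**: `Σ_{a ∈ fib k} |T_n(a)| ≤ Σ_{u ∈ (ℤ/2^k)ˣ} |A_{n,k}(u)|` — the map
`a ↦ (a+1)/2^(n-k) (mod 2^k)` is injective on the fibre and `|T_n(a)| = |A_{n,k}((a+1)/2^(n-k))|`.
[folklore] -/
theorem fiber_sum_le_unit_sum {n k : ℕ} (hk1 : 1 ≤ k) (hkn : k ≤ n) :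
    ∑ a ∈ fib n k, (|rowSum n a| : ℝ) ≤
      ∑ u : (ZMod (2 ^ k))ˣ, (|classSum n k (u : ZMod (2 ^ k)).val| : ℝ) := by
  have h1 : ∀ a ∈ fib n k, (|rowSum n a| : ℝ) =
      (|classSum n k ((unitOf k a : (ZMod (2 ^ k))ˣ) : ZMod (2 ^ k)).val| : ℝ) := by
    intro a ha
    have hv : val2 (a : ℕ) = n - k := (Finset.mem_filter.1 ha).2
    rw [unitOf_val (oddPart_lt a hk1 hkn hv)]
    have hs : (a : ℕ) + 1 = 2 ^ (n - k) * oddPart (a : ℕ) := by rw [← hv]; exact split_eq _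
    exact_mod_cast congrArg (fun z : ℤ => (z : ℝ)) (abs_rowSum_eq_of_split hkn hs)
  rw [Finset.sum_congr rfl h1]
  have hinj : Set.InjOn (fun a : Fin (2 ^ n) => unitOf k (a : ℕ)) (fib n k) := by
    intro a ha a' ha' he
    have hv : val2 (a : ℕ) = n - k := (Finset.mem_filter.1 (Finset.mem_coe.1 ha)).2
    have hv' : val2 (a' : ℕ) = n - k := (Finset.mem_filter.1 (Finset.mem_coe.1 ha')).2
    have h := congrArg (fun u : (ZMod (2 ^ k))ˣ => (u : ZMod (2 ^ k)).val) he
    simp only at h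
    rw [unitOf_val (oddPart_lt a hk1 hkn hv), unitOf_val (oddPart_lt a' hk1 hkn hv')] at h
    have e1 := split_eq (a : ℕ)
    have e2 := split_eq (a' : ℕ)
    rw [hv] at e1
    rw [hv', ← h] at e2
    exact Fin.ext (by omega)
  rw [← Finset.sum_image (f := fun u : (ZMod (2 ^ k))ˣ => (|classSum n k (u : ZMod (2 ^ k)).val| : ℝ))
    hinj]
  exact Finset.sum_le_sum_of_subset_of_nonneg (Finset.subset_univ _) fun _ _ _ => abs_nonneg _

/-- Number of units mod `2^k` is at most `2^k`. [folklore] -/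
theorem card_units_le (k : ℕ) : Fintype.card (ZMod (2 ^ k))ˣ ≤ 2 ^ k := by
  haveI : NeZero (2 ^ k) := ⟨pow_ne_zero _ two_ne_zero⟩
  rw [ZMod.card_units_eq_totient]
  exact Nat.totient_le _

/-- **Trivial fibre bound** (all `k ≤ n`): `Σ_{a ∈ fib k} |T_n(a)| ≤ 2^(n+k)`. [folklore] -/
theorem fiber_sum_le_trivial {n k : ℕ} (hkn : k ≤ n) :
    ∑ a ∈ fib n k, (|rowSum n a| : ℝ) ≤ 2 ^ (n + k) := by
  rcases Nat.eq_zero_or_pos k with rfl | hk1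
  · -- the fibre `k = 0` is `{2^n - 1}`
    have hcard : (fib n 0).card ≤ 1 := by
      refine Finset.card_le_one.2 fun a ha b hb => ?_
      have hva : val2 (a : ℕ) = n := by simpa [fib] using ha
      have hvb : val2 (b : ℕ) = n := by simpa [fib] using hb
      have ea := split_eq (a : ℕ); have eb := split_eq (b : ℕ)
      rw [hva] at ea; rw [hvb] at eb
      have pa := oddPart_pos (a : ℕ); have pb := oddPart_pos (b : ℕ)
      have la : (a : ℕ) + 1 ≤ 2 ^ n := a.isLt
      have lb : (b : ℕ) + 1 ≤ 2 ^ n := b.isLt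
      have h2 : 0 < 2 ^ n := Nat.two_pow_pos n
      have qa : oddPart (a : ℕ) = 1 := by
        rcases Nat.lt_or_ge 1 (oddPart (a : ℕ)) with h | h
        · nlinarith
        · omega
      have qb : oddPart (b : ℕ) = 1 := by
        rcases Nat.lt_or_ge 1 (oddPart (b : ℕ)) with h | h
        · nlinarith
        · omega
      rw [qa] at ea; rw [qb] at eb
      exact Fin.ext (by omega)
    calc ∑ a ∈ fib n 0, (|rowSum n a| : ℝ) ≤ ∑ _a ∈ fib n 0, (2 : ℝ) ^ n :=
          Finset.sum_le_sum fun a _ => by exact_mod_cast abs_rowSum_le n a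
      _ = (fib n 0).card * (2 : ℝ) ^ n := by rw [Finset.sum_const, nsmul_eq_mul]
      _ ≤ 1 * (2 : ℝ) ^ n := by gcongr; exact_mod_cast hcard
      _ = 2 ^ (n + 0) := by ring
  · calc ∑ a ∈ fib n k, (|rowSum n a| : ℝ)
        ≤ ∑ u : (ZMod (2 ^ k))ˣ, (|classSum n k (u : ZMod (2 ^ k)).val| : ℝ) :=
          fiber_sum_le_unit_sum hk1 hkn
      _ ≤ ∑ _u : (ZMod (2 ^ k))ˣ, (2 : ℝ) ^ n :=
          Finset.sum_le_sum fun u _ => by exact_mod_cast abs_classSum_le n k _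
      _ = Fintype.card (ZMod (2 ^ k))ˣ * (2 : ℝ) ^ n := by
          rw [Finset.sum_const, nsmul_eq_mul, Finset.card_univ]
      _ ≤ (2 : ℝ) ^ k * (2 : ℝ) ^ n := by gcongr; exact_mod_cast card_units_le k
      _ = 2 ^ (n + k) := by ring

end Summit.ValiantsHypothesis.ValiantsHypothesis.Theorems.LiouvilleSarnak.AlignedTypeI.CharactersModTwoN

end
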